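import Summits.AtomisticToContinuum.Crystallization.Theses.DisclinationRation
import Literature.Geometry.DiscreteGeometry.LayerShellPatterns
import Literature.MathematicalPhysics.StatisticalMechanics.BarlowRings
import Literature.MathematicalPhysics.StatisticalMechanics.PeriodicConfigurationDelone
import Literature.MathematicalPhysics.StatisticalMechanics.LocalMatchingCompactness
import Literature.Barriers.AtomisticToContinuum.KissingTwelveDegeneracy

/-!
# `BarlowLiouville` / Negative: the ground-state hypothesis is load-bearing (the scale is free without it)

Negative knowledge for crux `stmt-AtomisticToContinuum-15801` (`DisclinationRation.BarlowLiouville`, K3),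
crux-disprover seat, 2026-08-17.  Nothing here closes an item; no theorem concludes a Theses decl positively.
`BarlowLiouville` is definitionally `UniformPolytypeStability → Core`; `Core`: for every sequence `x` of
Lennard-Jones ground states and every `δ`-separated, relatively dense hull element `X` of `x` that is
everywhere `1/20`-{fcc,hcp}-good and Barlow-templated, `x` has LAYERED WINDOWS at every scale with ONE
in-layer spacing `a ∈ [47/50, 1]` (interlayer increments in `[39a/50, 17a/20]`).

* `barlowLiouville_core_false_without_groundState` — **`Core` with `∀ N, IsGroundState lennardJones (x N)`
  deleted (verbatim otherwise; the `UniformPolytypeStability` antecedent removed — a refuter cannot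
  discharge it) is FALSE.**  Witness `X = F₂ := fccStacking 2 (2√(2/3))`, the fcc packing of balls of
  DIAMETER 2, and `x N` = the first `N` points of an enumeration of `F₂`: `X` is `2`-separated, relatively
  dense, a hull element of `x` (`φ = id`, `τ = 0`), EXACTLY good at every point (Hales, *Dense Sphere
  Packings* §1.3 = `hasFccOrHcpShells_barlowStacking'`; the shell cutoff `13/10 · d(y) = 2.6 < 2√2` sees
  exactly the twelve touching points) and templated by `Φ = 2 • ·` (`l = 2`); but NO sequence drawn from
  `F₂` has a layered window in the box (`not_layeredWindows_of_forall_mem`: a window of radius `4`,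
  tolerance `1/10` contains two template points at distance `a ∈ [47/50, 1]`, whose matched particles are
  equal (`a ≤ 1/5`) or `≥ 2` apart (`2 ≤ a + 1/5`)).
* MESSAGE: the geometric hypotheses are scale-free (`δ` arbitrary, goodness dilation-invariant, template
  scale `l_p` free) while the box is an ABSOLUTE scale (relaxed LJ spacing `≈ 0.9712`): any proof must pin
  the nearest-neighbour distance of the hull element from `IsGroundState` (bulk optimality of hull
  elements, item 12090) BEFORE any Liouville/rigidity step.  All `[folklore]`; no new definitions.
-/

noncomputable section

namespace Summit.AtomisticToContinuum.Crystallization.Theorems.BarlowLiouville.Negative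

open Filter Set
open Literature.MathematicalPhysics.StatisticalMechanics Literature.Geometry.DiscreteGeometry



/-- **`(fccStacking 2 (2 * Real.sqrt (2 / 3)))` is `2`-separated** (a packing of balls of diameter `2`). [folklore] -/
theorem two_le_dist_fccTwo {y z : (EuclideanSpace ℝ (Fin 3))} (hy : y ∈ (fccStacking 2 (2 * Real.sqrt (2 / 3)))) (hz : z ∈ (fccStacking 2 (2 * Real.sqrt (2 / 3)))) (hyz : y ≠ z) : 2 ≤ dist y z :=
  le_dist_of_mem_barlowStacking_ideal isHaggSeq_const two_pos Literature.Barriers.AtomisticToContinuum.hales_layerSpacing_sq hy hz hyz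

/-- **`(fccStacking 2 (2 * Real.sqrt (2 / 3)))` is relatively dense** (it is the point set of a periodic configuration). [folklore] -/
theorem relDense_fccTwo : ∃ R₁ : ℝ, ∀ p : (EuclideanSpace ℝ (Fin 3)), ∃ y ∈ (fccStacking 2 (2 * Real.sqrt (2 / 3))), dist y p ≤ R₁ := by
  obtain ⟨r, -, hr⟩ :=
    (fccPeriodicConfiguration (two_ne_zero (α := ℝ)) (by positivity : (0 : ℝ) < 2 * Real.sqrt (2 / 3)).ne').exists_forall_exists_dist_le
  refine ⟨r, fun p => ?_⟩
  obtain ⟨y, hy, hyp⟩ := hr p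
  rw [fccPeriodicConfiguration_points] at hy
  exact ⟨y, hy, hyp⟩

/-- The point above `(k, i, j)` is at distance exactly `2`. [folklore] -/
theorem dist_succ_fccTwo (k i j : ℤ) :
    dist (barlowPos 2 (2 * Real.sqrt (2 / 3)) constHagg (k + 1) i j)
      (barlowPos 2 (2 * Real.sqrt (2 / 3)) constHagg k i j) = 2 := by
  rw [dist_barlowPos_succ_eq 2 (2 * Real.sqrt (2 / 3)) isHaggSeq_const, Literature.Barriers.AtomisticToContinuum.hales_layerSpacing_sq,
    show (2 : ℝ) ^ 2 / 3 + 2 / 3 * 2 ^ 2 = 2 ^ 2 by norm_num]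
  exact Real.sqrt_sq zero_le_two

/-- **The local scale of `(fccStacking 2 (2 * Real.sqrt (2 / 3)))` is `d(y) = 2` at every point.** [folklore] -/
theorem sInf_dist_fccTwo {y : (EuclideanSpace ℝ (Fin 3))} (hy : y ∈ (fccStacking 2 (2 * Real.sqrt (2 / 3)))) :
    sInf ((fun z => dist z y) '' ((fccStacking 2 (2 * Real.sqrt (2 / 3))) \ {y})) = 2 := by
  obtain ⟨k, i, j, rfl⟩ := hy
  refine IsLeast.csInf_eq ⟨?_, ?_⟩
  · refine ⟨barlowPos 2 (2 * Real.sqrt (2 / 3)) constHagg (k + 1) i j, ⟨barlowPos_mem _ _ _, ?_⟩,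
      dist_succ_fccTwo k i j⟩
    intro h
    have h2 := dist_succ_fccTwo k i j
    rw [Set.mem_singleton_iff.1 h, dist_self] at h2
    norm_num at h2
  · rintro r ⟨z, ⟨hz, hzy⟩, rfl⟩
    exact two_le_dist_fccTwo hz (barlowPos_mem _ _ _) fun h => hzy (Set.mem_singleton_iff.2 h)

/-- `13/10 · 2 < √2 · 2`: the shell cutoff lies in the distance gap `(2, 2√2)` of `(fccStacking 2 (2 * Real.sqrt (2 / 3)))`. [folklore] -/
theorem cutoff_lt : (13 / 10 * 2 : ℝ) < Real.sqrt 2 * 2 := by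
  have h : (13 / 10 : ℝ) < Real.sqrt 2 := by
    rw [show (13 / 10 : ℝ) = Real.sqrt ((13 / 10) ^ 2) by rw [Real.sqrt_sq (by norm_num)]]
    exact Real.sqrt_lt_sqrt (by norm_num) (by norm_num)
  linarith

/-- **The goodness shell is the kissing shell**: a point of `(fccStacking 2 (2 * Real.sqrt (2 / 3))) ∖ {y}` within `13/10 · 2` of `y` touches `y`. [folklore] -/
theorem dist_eq_two_of_lt {y z : (EuclideanSpace ℝ (Fin 3))} (hy : y ∈ (fccStacking 2 (2 * Real.sqrt (2 / 3)))) (hz : z ∈ (fccStacking 2 (2 * Real.sqrt (2 / 3)))) (hzy : z ≠ y)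
    (hd : dist z y < 13 / 10 * 2) : dist z y = 2 :=
  (eq_or_dist_eq_of_dist_lt isHaggSeq_const two_pos Literature.Barriers.AtomisticToContinuum.hales_layerSpacing_sq hz hy (hd.trans cutoff_lt)).resolve_left hzy

/-- **Exact pattern match of a shell of `(fccStacking 2 (2 * Real.sqrt (2 / 3)))`.** If the kissing shell of `y ∈ (fccStacking 2 (2 * Real.sqrt (2 / 3)))` is `2 · A(P)` for a
pattern `P` and a linear isometry `A` (Hales's `IsArrangedIn`), then the shell of the goodness predicate
(cutoff `13/10 · 2`) is in bijection with `P`, each rescaled point sitting EXACTLY on its pattern point.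
[folklore] -/
theorem shellEquiv_fccTwo {y : (EuclideanSpace ℝ (Fin 3))} (hy : y ∈ (fccStacking 2 (2 * Real.sqrt (2 / 3)))) {P : Finset (EuclideanSpace ℝ (Fin 3))} (A : (EuclideanSpace ℝ (Fin 3)) →ₗᵢ[ℝ] (EuclideanSpace ℝ (Fin 3)))
    (hA : kissingShell (fccStacking 2 (2 * Real.sqrt (2 / 3))) y = (fun p => (2 : ℝ) • A p) '' (P : Set (EuclideanSpace ℝ (Fin 3)))) :
    ∃ e : ↥{z : (EuclideanSpace ℝ (Fin 3)) | z ∈ (fccStacking 2 (2 * Real.sqrt (2 / 3))) ∧ z ≠ y ∧ dist z y < 13 / 10 * 2} ≃ ↥P,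
      ∀ t : ↥{z : (EuclideanSpace ℝ (Fin 3)) | z ∈ (fccStacking 2 (2 * Real.sqrt (2 / 3))) ∧ z ≠ y ∧ dist z y < 13 / 10 * 2},
        dist ((2 : ℝ)⁻¹ • ((t : (EuclideanSpace ℝ (Fin 3))) - y)) (A ((e t : ↥P) : (EuclideanSpace ℝ (Fin 3)))) ≤ 1 / 20 := by
  -- the map pattern point ↦ touching point
  have hmem : ∀ p : ↥P,
      y + (2 : ℝ) • A (p : (EuclideanSpace ℝ (Fin 3))) ∈ {z : (EuclideanSpace ℝ (Fin 3)) | z ∈ (fccStacking 2 (2 * Real.sqrt (2 / 3))) ∧ z ≠ y ∧ dist z y < 13 / 10 * 2} := by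
    intro p
    have h1 : (2 : ℝ) • A (p : (EuclideanSpace ℝ (Fin 3))) ∈ kissingShell (fccStacking 2 (2 * Real.sqrt (2 / 3))) y := by
      rw [hA]
      exact ⟨p, p.2, rfl⟩
    obtain ⟨hyF, hnorm⟩ := h1
    have hdist : dist (y + (2 : ℝ) • A (p : (EuclideanSpace ℝ (Fin 3)))) y = 2 := by
      rw [dist_eq_norm, add_sub_cancel_left, hnorm]
    refine ⟨hyF, fun h => ?_, by rw [hdist]; norm_num⟩
    rw [h, dist_self] at hdist
    norm_num at hdist
  have hf_inj : Function.Injective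
      (fun p : ↥P => (⟨y + (2 : ℝ) • A (p : (EuclideanSpace ℝ (Fin 3))), hmem p⟩ :
        ↥{z : (EuclideanSpace ℝ (Fin 3)) | z ∈ (fccStacking 2 (2 * Real.sqrt (2 / 3))) ∧ z ≠ y ∧ dist z y < 13 / 10 * 2})) := by
    intro p q hpq
    have h1 : y + (2 : ℝ) • A (p : (EuclideanSpace ℝ (Fin 3))) = y + (2 : ℝ) • A (q : (EuclideanSpace ℝ (Fin 3))) := congrArg Subtype.val hpq
    have h2 : (2 : ℝ) • A (p : (EuclideanSpace ℝ (Fin 3))) = (2 : ℝ) • A (q : (EuclideanSpace ℝ (Fin 3))) := add_left_cancel h1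
    exact Subtype.ext (A.injective (smul_right_injective (EuclideanSpace ℝ (Fin 3)) (two_ne_zero (α := ℝ)) h2))
  have hf_surj : Function.Surjective
      (fun p : ↥P => (⟨y + (2 : ℝ) • A (p : (EuclideanSpace ℝ (Fin 3))), hmem p⟩ :
        ↥{z : (EuclideanSpace ℝ (Fin 3)) | z ∈ (fccStacking 2 (2 * Real.sqrt (2 / 3))) ∧ z ≠ y ∧ dist z y < 13 / 10 * 2})) := by
    rintro ⟨t, htF, hty, htd⟩
    have hd2 : dist t y = 2 := dist_eq_two_of_lt hy htF hty htd
    have hks : t - y ∈ kissingShell (fccStacking 2 (2 * Real.sqrt (2 / 3))) y :=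
      ⟨by rw [add_sub_cancel]; exact htF, by rw [← dist_eq_norm]; exact hd2⟩
    rw [hA] at hks
    obtain ⟨p, hp, hpt⟩ := hks
    refine ⟨⟨p, hp⟩, Subtype.ext ?_⟩
    have hpt' : (2 : ℝ) • A p = t - y := hpt
    show y + (2 : ℝ) • A p = t
    rw [hpt', add_sub_cancel]
  refine ⟨(Equiv.ofBijective _ ⟨hf_inj, hf_surj⟩).symm, fun t => ?_⟩
  have ht := Equiv.ofBijective_apply_symm_apply _ ⟨hf_inj, hf_surj⟩ t
  have hval : (t : (EuclideanSpace ℝ (Fin 3))) = y + (2 : ℝ) • A ((Equiv.ofBijective _ ⟨hf_inj, hf_surj⟩).symm t : ↥P) :=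
    (congrArg Subtype.val ht).symm
  rw [hval, add_sub_cancel_left, smul_smul, inv_mul_cancel₀ (two_ne_zero (α := ℝ)), one_smul,
    dist_self]
  norm_num

/-- **Every point of `(fccStacking 2 (2 * Real.sqrt (2 / 3)))` is EXACTLY `1/20`-{fcc,hcp}-good** (in fact with error `0`): the goodness
clause `GF (fccStacking 2 (2 * Real.sqrt (2 / 3))) y` of the crux, verbatim. [cite: HalesDSP2012, §1.3 (pp. 12–13)] -/
theorem siteGood_fccTwo {y : (EuclideanSpace ℝ (Fin 3))} (hy : y ∈ (fccStacking 2 (2 * Real.sqrt (2 / 3)))) :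
    let d : ℝ := sInf ((fun z => dist z y) '' (Literature.MathematicalPhysics.StatisticalMechanics.fccStacking 2 (2 * Real.sqrt (2 / 3)) \ {y})); let T : Set (EuclideanSpace ℝ (Fin 3)) := {z : EuclideanSpace ℝ (Fin 3) | z ∈ Literature.MathematicalPhysics.StatisticalMechanics.fccStacking 2 (2 * Real.sqrt (2 / 3)) ∧ z ≠ y ∧ dist z y < 13 / 10 * d}; ∃ A : EuclideanSpace ℝ (Fin 3) →ₗᵢ[ℝ] EuclideanSpace ℝ (Fin 3), (∃ e : ↥T ≃ ↥Literature.Geometry.DiscreteGeometry.fccKissingPattern, ∀ t : ↥T, dist (d⁻¹ • ((t : EuclideanSpace ℝ (Fin 3)) - y)) (A ((e t : ↥Literature.Geometry.DiscreteGeometry.fccKissingPattern) : EuclideanSpace ℝ (Fin 3))) ≤ 1 / 20) ∨ (∃ e : ↥T ≃ ↥Literature.Geometry.DiscreteGeometry.hcpKissingPattern, ∀ t : ↥T, dist (d⁻¹ • ((t : EuclideanSpace ℝ (Fin 3)) - y)) (A ((e t : ↥Literature.Geometry.DiscreteGeometry.hcpKissingPattern) : EuclideanSpace ℝ (Fin 3)))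 ≤ 1 / 20) := by
  dsimp only
  rw [sInf_dist_fccTwo hy]
  rcases hasFccOrHcpShells_barlowStacking' isHaggSeq_const y hy with ⟨A, hA⟩ | ⟨A, hA⟩
  · exact ⟨A, Or.inl (shellEquiv_fccTwo hy A hA)⟩
  · exact ⟨A, Or.inr (shellEquiv_fccTwo hy A hA)⟩

/-- Doubling the unit template gives `(fccStacking 2 (2 * Real.sqrt (2 / 3)))`'s points. [folklore] -/
theorem two_smul_barlowPos_one (s : ℤ → ℤ) (k i j : ℤ) :
    (2 : ℝ) • barlowPos 1 (Real.sqrt (2 / 3)) s k i j =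
      barlowPos 2 (2 * Real.sqrt (2 / 3)) s k i j := by
  ext l
  fin_cases l <;> simp <;> ring

/-- **`(fccStacking 2 (2 * Real.sqrt (2 / 3)))` is Barlow-templated**: it is the bijective image of the ideal template
`barlowStacking 1 √(2/3) constHagg` under the homothety `Φ = 2 • ·`, which IS a similarity of ratio
`l = 2` (error `0 ≤ 1/20 · 2`) — the template clause of the crux, verbatim. [folklore] -/
theorem templated_fccTwo :
    (∃ s : ℤ → ℤ, Literature.MathematicalPhysics.StatisticalMechanics.IsHaggSeq s ∧ ∃ Φ : EuclideanSpace ℝ (Fin 3) → EuclideanSpace ℝ (Fin 3), Set.BijOn Φ (Literature.MathematicalPhysics.StatisticalMechanics.barlowStacking 1 (Real.sqrt (2 / 3)) s) (fccStacking 2 (2 * Real.sqrt (2 / 3))) ∧ ∀ p ∈ Literature.MathematicalPhysics.StatisticalMechanics.barlowStacking 1 (Real.sqrt (2 / 3)) s, ∃ A : EuclideanSpace ℝ (Fin 3) →ₗᵢ[ℝ] EuclideanSpace ℝ (Fin 3), ∃ l : ℝ, 0 < l ∧ ∀ q ∈ Literature.MathematicalPhysics.StatisticalMechanics.barlowStacking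 1 (Real.sqrt (2 / 3)) s, dist q p ≤ 1 → dist (Φ q) (Φ p + l • A (q - p)) ≤ 1 / 20 * l) := by
  refine ⟨constHagg, isHaggSeq_const, fun v => (2 : ℝ) • v, ⟨?_, ?_, ?_⟩, ?_⟩
  · rintro p ⟨k, i, j, rfl⟩
    exact ⟨k, i, j, two_smul_barlowPos_one constHagg k i j⟩
  · exact (smul_right_injective (EuclideanSpace ℝ (Fin 3)) (two_ne_zero (α := ℝ))).injOn
  · rintro p ⟨k, i, j, rfl⟩
    exact ⟨barlowPos 1 (Real.sqrt (2 / 3)) constHagg k i j, barlowPos_mem _ _ _,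
      two_smul_barlowPos_one constHagg k i j⟩
  · intro p _
    refine ⟨LinearIsometry.id, 2, two_pos, fun q _ _ => ?_⟩
    rw [LinearIsometry.id_apply, smul_sub, add_sub_cancel, dist_self]
    norm_num


/-- Distinct index triples give distinct points of `(fccStacking 2 (2 * Real.sqrt (2 / 3)))`. [folklore] -/
theorem barlowPosTwo_injective : Function.Injective
    (fun q : ℤ × ℤ × ℤ => barlowPos 2 (2 * Real.sqrt (2 / 3)) constHagg q.1 q.2.1 q.2.2) := by
  rintro ⟨k, i, j⟩ ⟨k', i', j'⟩ h
  by_contra hne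
  have h2 := le_dist_barlowPos 2 (2 * Real.sqrt (2 / 3)) constHagg zero_le_two (by positivity : (0 : ℝ) < 2 * Real.sqrt (2 / 3)).le
    (k := k) (i := i) (j := j) (k' := k') (i' := i') (j' := j')
    (by simpa [Prod.ext_iff] using hne)
  have h3 : (0 : ℝ) < min 2 (2 * Real.sqrt (2 / 3)) := lt_min two_pos (by positivity)
  have h4 : dist (barlowPos 2 (2 * Real.sqrt (2 / 3)) constHagg k i j)
      (barlowPos 2 (2 * Real.sqrt (2 / 3)) constHagg k' i' j') = 0 := dist_eq_zero.2 h
  linarith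

/-- Only finitely many indices give points of `(fccStacking 2 (2 * Real.sqrt (2 / 3)))` in a ball (`(fccStacking 2 (2 * Real.sqrt (2 / 3)))` is `2`-separated). [folklore] -/
theorem finite_idx_fccTwo (R : ℝ) :
    {q : ℤ × ℤ × ℤ | ‖barlowPos 2 (2 * Real.sqrt (2 / 3)) constHagg q.1 q.2.1 q.2.2‖ ≤ R}.Finite := by
  have hfin : {p : (EuclideanSpace ℝ (Fin 3)) | p ∈ (fccStacking 2 (2 * Real.sqrt (2 / 3))) ∧ ‖p‖ ≤ R}.Finite := by
    refine finite_of_forall_le_dist_of_subset_closedBall (δ := 2) two_pos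
      (fun p hp q hq hpq => two_le_dist_fccTwo hp.1 hq.1 hpq) (c := 0) (R := R) fun p hp => ?_
    rw [Metric.mem_closedBall, dist_zero_right]
    exact hp.2
  refine (hfin.preimage barlowPosTwo_injective.injOn).subset fun q hq => ?_
  exact ⟨barlowPos_mem _ _ _, hq⟩

/-- **`(fccStacking 2 (2 * Real.sqrt (2 / 3)))` is a hull element of `(fun (N : ℕ) (i : Fin N) => barlowPos 2 (2 * Real.sqrt (2 / 3)) constHagg (Prod.fst (Equiv.symm (Denumerable.eqv (ℤ × ℤ × ℤ)) (i : ℕ))) (Prod.fst (Prod.snd (Equiv.symm (Denumerable.eqv (ℤ × ℤ × ℤ)) (i : ℕ)))) (Prod.snd (Prod.snd (Equiv.symm (Denumerable.eqv (ℤ × ℤ × ℤ)) (i : ℕ)))))`** (along `φ = id`, with `τ = 0`): every ball meets `(fccStacking 2 (2 * Real.sqrt (2 / 3)))` in finitely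
many points, all of which are listed by `(fun (N : ℕ) (i : Fin N) => barlowPos 2 (2 * Real.sqrt (2 / 3)) constHagg (Prod.fst (Equiv.symm (Denumerable.eqv (ℤ × ℤ × ℤ)) (i : ℕ))) (Prod.fst (Prod.snd (Equiv.symm (Denumerable.eqv (ℤ × ℤ × ℤ)) (i : ℕ)))) (Prod.snd (Prod.snd (Equiv.symm (Denumerable.eqv (ℤ × ℤ × ℤ)) (i : ℕ))))) N` for `N` large; and every particle of `(fun (N : ℕ) (i : Fin N) => barlowPos 2 (2 * Real.sqrt (2 / 3)) constHagg (Prod.fst (Equiv.symm (Denumerable.eqv (ℤ × ℤ × ℤ)) (i : ℕ))) (Prod.fst (Prod.snd (Equiv.symm (Denumerable.eqv (ℤ × ℤ × ℤ)) (i : ℕ)))) (Prod.snd (Prod.snd (Equiv.symm (Denumerable.eqv (ℤ × ℤ × ℤ)) (i : ℕ))))) N` is a point of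
`(fccStacking 2 (2 * Real.sqrt (2 / 3)))`.  The hull clause `HL (fun (N : ℕ) (i : Fin N) => barlowPos 2 (2 * Real.sqrt (2 / 3)) constHagg (Prod.fst (Equiv.symm (Denumerable.eqv (ℤ × ℤ × ℤ)) (i : ℕ))) (Prod.fst (Prod.snd (Equiv.symm (Denumerable.eqv (ℤ × ℤ × ℤ)) (i : ℕ)))) (Prod.snd (Prod.snd (Equiv.symm (Denumerable.eqv (ℤ × ℤ × ℤ)) (i : ℕ))))) (fccStacking 2 (2 * Real.sqrt (2 / 3)))` of the crux, verbatim. [folklore] -/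
theorem hull_fccTwo :
    ∃ φ : ℕ → ℕ, StrictMono φ ∧ ∃ τ : ℕ → EuclideanSpace ℝ (Fin 3), ∀ R ε : ℝ, 0 < ε → ∀ᶠ j : ℕ in Filter.atTop, (∀ s ∈ (fccStacking 2 (2 * Real.sqrt (2 / 3))), ‖s‖ ≤ R → ∃ i : Fin (φ j), dist ((fun (N : ℕ) (i : Fin N) => barlowPos 2 (2 * Real.sqrt (2 / 3)) constHagg (Prod.fst (Equiv.symm (Denumerable.eqv (ℤ × ℤ × ℤ)) (i : ℕ))) (Prod.fst (Prod.snd (Equiv.symm (Denumerable.eqv (ℤ × ℤ × ℤ)) (i : ℕ)))) (Prod.snd (Prod.snd (Equiv.symm (Denumerable.eqv (ℤ × ℤ × ℤ)) (i : ℕ))))) (φ j) i + τ j) s ≤ ε) ∧ (∀ i : Fin (φ j), ‖(fun (N : ℕ) (i : Fin N) => barlowPos 2 (2 * Real.sqrt (2 / 3)) constHagg (Prod.fst (Equiv.symm (Denumerable.eqv (ℤ × ℤ × ℤ)) (i : ℕ))) (Prod.fst (Prod.snd (Equiv.symm (Denumerable.eqv (ℤ × ℤ × ℤ)) (i : ℕ))))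 (Prod.snd (Prod.snd (Equiv.symm (Denumerable.eqv (ℤ × ℤ × ℤ)) (i : ℕ))))) (φ j) i + τ j‖ ≤ R → ∃ s ∈ (fccStacking 2 (2 * Real.sqrt (2 / 3))), dist ((fun (N : ℕ) (i : Fin N) => barlowPos 2 (2 * Real.sqrt (2 / 3)) constHagg (Prod.fst (Equiv.symm (Denumerable.eqv (ℤ × ℤ × ℤ)) (i : ℕ))) (Prod.fst (Prod.snd (Equiv.symm (Denumerable.eqv (ℤ × ℤ × ℤ)) (i : ℕ)))) (Prod.snd (Prod.snd (Equiv.symm (Denumerable.eqv (ℤ × ℤ × ℤ)) (i : ℕ))))) (φ j) i + τ j) s ≤ ε) := by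
  refine ⟨id, strictMono_id, fun _ => 0, fun R ε hε => ?_⟩
  obtain ⟨B, hB⟩ := ((finite_idx_fccTwo R).image (Denumerable.eqv (ℤ × ℤ × ℤ))).bddAbove
  rw [Filter.eventually_atTop]
  refine ⟨B + 1, fun N hN => ⟨?_, ?_⟩⟩
  · rintro s ⟨k, i, j, rfl⟩ hs
    have hq : (k, i, j) ∈ {q : ℤ × ℤ × ℤ |
        ‖barlowPos 2 (2 * Real.sqrt (2 / 3)) constHagg q.1 q.2.1 q.2.2‖ ≤ R} := hs
    have hle : Denumerable.eqv (ℤ × ℤ × ℤ) (k, i, j) ≤ B := hB (Set.mem_image_of_mem _ hq)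
    refine ⟨⟨Denumerable.eqv (ℤ × ℤ × ℤ) (k, i, j), by simp only [id]; omega⟩, ?_⟩
    simp [hε.le]
  · intro i _
    exact ⟨(fun (N : ℕ) (i : Fin N) => barlowPos 2 (2 * Real.sqrt (2 / 3)) constHagg (Prod.fst (Equiv.symm (Denumerable.eqv (ℤ × ℤ × ℤ)) (i : ℕ))) (Prod.fst (Prod.snd (Equiv.symm (Denumerable.eqv (ℤ × ℤ × ℤ)) (i : ℕ)))) (Prod.snd (Prod.snd (Equiv.symm (Denumerable.eqv (ℤ × ℤ × ℤ)) (i : ℕ))))) (id N) i, barlowPos_mem _ _ _, by simp [hε.le]⟩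


/-- **A layer near height `0`.** Heights `z : ℤ → ℝ` with increments in `[39a/50, 17a/20]`, `a ≥ 47/50`,
take a value in `[0, 17a/20)` (at the least index of nonnegative height). [folklore] -/
theorem exists_layer_near_zero {a : ℝ} (ha : 47 / 50 ≤ a) {z : ℤ → ℝ}
    (hz : ∀ m : ℤ, 39 / 50 * a ≤ z (m + 1) - z m ∧ z (m + 1) - z m ≤ 17 / 20 * a) :
    ∃ m : ℤ, 0 ≤ z m ∧ z m < 17 / 20 * a := by
  have hc : (0 : ℝ) < 39 / 50 * a := by linarith
  have hup : ∀ n : ℕ, z 0 + 39 / 50 * a * n ≤ z n := by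
    intro n
    induction n with
    | zero => simp
    | succ n ih =>
      have h1 := (hz n).1
      push_cast at h1 ⊢
      linarith
  have hdown : ∀ n : ℕ, z (-(n : ℤ)) ≤ z 0 - 39 / 50 * a * n := by
    intro n
    induction n with
    | zero => simp
    | succ n ih =>
      have h1 := (hz (-((n + 1 : ℕ) : ℤ))).1
      rw [show -((n + 1 : ℕ) : ℤ) + 1 = -(n : ℤ) by push_cast; ring] at h1
      push_cast at h1 ⊢
      linarith
  have hne : ∃ m : ℤ, 0 ≤ z m := by
    obtain ⟨n, hn⟩ := exists_nat_ge (-z 0 / (39 / 50 * a))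
    rw [div_le_iff₀ hc] at hn
    exact ⟨n, by linarith [hup n]⟩
  have hbdd : ∃ b : ℤ, ∀ m : ℤ, 0 ≤ z m → b ≤ m := by
    obtain ⟨n₁, hn₁⟩ := exists_nat_gt (z 0 / (39 / 50 * a))
    refine ⟨-(n₁ : ℤ), fun m hm => ?_⟩
    by_contra hlt
    have hlt' : m < -(n₁ : ℤ) := lt_of_not_ge hlt
    obtain ⟨n, rfl⟩ : ∃ n : ℕ, m = -(n : ℤ) := ⟨(-m).toNat, by omega⟩
    have hn : (n₁ : ℝ) < n := by exact_mod_cast (show n₁ < n by omega)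
    rw [div_lt_iff₀ hc] at hn₁
    linarith [hdown n, mul_lt_mul_of_pos_left hn hc]
  obtain ⟨m, hm0, hmin⟩ := Int.exists_least_of_bdd hbdd hne
  refine ⟨m, hm0, ?_⟩
  have hneg : z (m - 1) < 0 := by
    by_contra h
    have := hmin (m - 1) (not_lt.1 h)
    omega
  have h2 := (hz (m - 1)).2
  rw [sub_add_cancel] at h2
  linarith

/-- Coordinates of a point of the crux's layered set (before the rigid motion). [folklore] -/
theorem layeredPoint_apply (a : ℝ) (L i j : ℤ) (ζ : ℝ) :
    (((i : ℝ) • triangularVec₁ a) + ((j : ℝ) • triangularVec₂ a) + ((L : ℝ) • barlowOffset a) +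
        (ζ • layerNormal 1)) 0 = a * (i + j / 2 + L / 2) ∧
      (((i : ℝ) • triangularVec₁ a) + ((j : ℝ) • triangularVec₂ a) + ((L : ℝ) • barlowOffset a) +
        (ζ • layerNormal 1)) 1 = a * Real.sqrt 3 / 2 * (j + L / 3) ∧
      (((i : ℝ) • triangularVec₁ a) + ((j : ℝ) • triangularVec₂ a) + ((L : ℝ) • barlowOffset a) +
        (ζ • layerNormal 1)) 2 = ζ := by
  refine ⟨?_, ?_, ?_⟩ <;> simp [triangularVec₁, triangularVec₂, barlowOffset, layerNormal] <;> ring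

/-- **A point of every layer within `3` of the axis**: writing the letter `L = 3q + r`, `r ∈ {0,1,2}`, the
point `(i, j) = (-q, -q)` of a layer of height `ζ ∈ [0, 17a/20)` has norm `≤ 3` (`a ≤ 1`). [folklore] -/
theorem norm_layeredPoint_le {a : ℝ} (ha0 : 0 ≤ a) (ha1 : a ≤ 1) (q r : ℤ) (hr0 : 0 ≤ r) (hr3 : r < 3)
    {ζ : ℝ} (hζ0 : 0 ≤ ζ) (hζ1 : ζ < 17 / 20 * a) :
    ‖(((-q : ℤ) : ℝ) • triangularVec₁ a) + (((-q : ℤ) : ℝ) • triangularVec₂ a) +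
        (((3 * q + r : ℤ) : ℝ) • barlowOffset a) + (ζ • layerNormal 1)‖ ≤ 3 := by
  have h3 : Real.sqrt 3 ^ 2 = 3 := Real.sq_sqrt (by norm_num)
  obtain ⟨h0, h1, h2⟩ := layeredPoint_apply a (3 * q + r) (-q) (-q) ζ
  have hsq : ‖(((-q : ℤ) : ℝ) • triangularVec₁ a) + (((-q : ℤ) : ℝ) • triangularVec₂ a) +
        (((3 * q + r : ℤ) : ℝ) • barlowOffset a) + (ζ • layerNormal 1)‖ ^ 2 =
      a ^ 2 * (r : ℝ) ^ 2 / 4 + a ^ 2 * (r : ℝ) ^ 2 / 12 + ζ ^ 2 := by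
    rw [EuclideanSpace.norm_sq_eq, Fin.sum_univ_three, Real.norm_eq_abs, Real.norm_eq_abs,
      Real.norm_eq_abs, sq_abs, sq_abs, sq_abs, h0, h1, h2]
    push_cast
    linear_combination (a ^ 2 * (r : ℝ) ^ 2 / 36) * h3
  have hr2 : (r : ℝ) ≤ 2 := by exact_mod_cast (show r ≤ 2 by omega)
  have hr0' : (0 : ℝ) ≤ r := by exact_mod_cast hr0
  have ha2 : a ^ 2 ≤ 1 := by nlinarith
  have hr4 : (r : ℝ) ^ 2 ≤ 4 := by nlinarith
  have har : a ^ 2 * (r : ℝ) ^ 2 ≤ 1 * 4 := mul_le_mul ha2 hr4 (sq_nonneg _) zero_le_one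
  have hζ2 : ζ ^ 2 ≤ 1 := by nlinarith
  have hbound : ‖(((-q : ℤ) : ℝ) • triangularVec₁ a) + (((-q : ℤ) : ℝ) • triangularVec₂ a) +
        (((3 * q + r : ℤ) : ℝ) • barlowOffset a) + (ζ • layerNormal 1)‖ ^ 2 ≤ 3 ^ 2 := by
    rw [hsq]
    linarith
  exact (pow_le_pow_iff_left₀ (norm_nonneg _) (by norm_num) two_ne_zero).1 hbound

/-- **No layered windows at the wrong scale.** A sequence of finite configurations all of whose particles
are points of `(fccStacking 2 (2 * Real.sqrt (2 / 3)))` (pairwise equal or `≥ 2` apart) has NO layered window in the crux's box: the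
conclusion of the crux fails for it — already at radius `4`, tolerance `1/10`. [folklore] -/
theorem not_layeredWindows_of_forall_mem {x : (N : ℕ) → (Fin N → (EuclideanSpace ℝ (Fin 3)))} (hx : ∀ N i, x N i ∈ (fccStacking 2 (2 * Real.sqrt (2 / 3)))) :
    ¬ (∃ a : ℝ, 47 / 50 ≤ a ∧ a ≤ 1 ∧ ∀ R ε : ℝ, 0 < ε → ∃ᶠ N in Filter.atTop, ∃ (A : EuclideanSpace ℝ (Fin 3) →ₗᵢ[ℝ] EuclideanSpace ℝ (Fin 3)) (t : EuclideanSpace ℝ (Fin 3)) (s : ℤ → ℤ) (z : ℤ → ℝ), Literature.MathematicalPhysics.StatisticalMechanics.IsHaggSeq s ∧ (∀ m : ℤ, 39 / 50 * a ≤ z (m + 1) - z m ∧ z (m + 1) - z m ≤ 17 / 20 * a) ∧ let S : Set (EuclideanSpace ℝ (Fin 3)) := {p | ∃ m i j : ℤ, p = A (((i : ℝ) • Literature.MathematicalPhysics.StatisticalMechanics.triangularVec₁ a) + ((j : ℝ) • Literature.MathematicalPhysics.StatisticalMechanics.triangularVec₂ a) + ((Literature.MathematicalPhysics.StatisticalMechanics.haggLabel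 s m : ℝ) • Literature.MathematicalPhysics.StatisticalMechanics.barlowOffset a) + (z m • Literature.MathematicalPhysics.StatisticalMechanics.layerNormal 1))}; (∀ p ∈ S, ‖p‖ ≤ R → ∃ i : Fin N, dist (x N i + t) p ≤ ε) ∧ (∀ i : Fin N, ‖x N i + t‖ ≤ R → ∃ p ∈ S, dist (x N i + t) p ≤ ε)) := by
  rintro ⟨a, ha0, ha1, h⟩
  obtain ⟨N, A, t, s, z, -, hz, hmatch⟩ := (h 4 (1 / 10) (by norm_num)).exists
  obtain ⟨hM, -⟩ := hmatch
  obtain ⟨m, hm0, hm1⟩ := exists_layer_near_zero ha0 hz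
  obtain ⟨q, r, hqr, hr0, hr3⟩ : ∃ q r : ℤ, haggLabel s m = 3 * q + r ∧ 0 ≤ r ∧ r < 3 :=
    ⟨haggLabel s m / 3, haggLabel s m % 3, by omega, by omega, by omega⟩
  -- two template points in the window, at distance `a`
  have hnu : ‖triangularVec₁ a‖ = a := by
    rw [EuclideanSpace.norm_eq, Fin.sum_univ_three]
    simp [triangularVec₁, Real.sqrt_sq (show (0 : ℝ) ≤ a by linarith)]
  have hv₀ : ‖(((-q : ℤ) : ℝ) • triangularVec₁ a) + (((-q : ℤ) : ℝ) • triangularVec₂ a) +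
      ((haggLabel s m : ℝ) • barlowOffset a) + (z m • layerNormal 1)‖ ≤ 3 := by
    rw [hqr]
    exact norm_layeredPoint_le (by linarith) ha1 q r hr0 hr3 hm0 hm1
  have hdiff : ((((1 - q : ℤ) : ℝ) • triangularVec₁ a) + (((-q : ℤ) : ℝ) • triangularVec₂ a) +
      ((haggLabel s m : ℝ) • barlowOffset a) + (z m • layerNormal 1)) -
      ((((-q : ℤ) : ℝ) • triangularVec₁ a) + (((-q : ℤ) : ℝ) • triangularVec₂ a) +
      ((haggLabel s m : ℝ) • barlowOffset a) + (z m • layerNormal 1)) = triangularVec₁ a := by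
    push_cast
    module
  have hv₁ : ‖(((1 - q : ℤ) : ℝ) • triangularVec₁ a) + (((-q : ℤ) : ℝ) • triangularVec₂ a) +
      ((haggLabel s m : ℝ) • barlowOffset a) + (z m • layerNormal 1)‖ ≤ 4 := by
    have := norm_sub_le_norm_sub_add_norm_sub
      ((((1 - q : ℤ) : ℝ) • triangularVec₁ a) + (((-q : ℤ) : ℝ) • triangularVec₂ a) +
        ((haggLabel s m : ℝ) • barlowOffset a) + (z m • layerNormal 1))
      ((((-q : ℤ) : ℝ) • triangularVec₁ a) + (((-q : ℤ) : ℝ) • triangularVec₂ a) +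
        ((haggLabel s m : ℝ) • barlowOffset a) + (z m • layerNormal 1)) 0
    rw [sub_zero, sub_zero, hdiff, hnu] at this
    linarith
  obtain ⟨i₀, hi₀⟩ := hM _ ⟨m, -q, -q, rfl⟩ (by rw [LinearIsometry.norm_map]; linarith)
  obtain ⟨i₁, hi₁⟩ := hM _ ⟨m, 1 - q, -q, rfl⟩ (by rw [LinearIsometry.norm_map]; exact hv₁)
  have hdist : dist (A ((((-q : ℤ) : ℝ) • triangularVec₁ a) + (((-q : ℤ) : ℝ) • triangularVec₂ a) +
      ((haggLabel s m : ℝ) • barlowOffset a) + (z m • layerNormal 1)))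
      (A ((((1 - q : ℤ) : ℝ) • triangularVec₁ a) + (((-q : ℤ) : ℝ) • triangularVec₂ a) +
      ((haggLabel s m : ℝ) • barlowOffset a) + (z m • layerNormal 1))) = a := by
    rw [dist_comm, dist_eq_norm, ← map_sub, LinearIsometry.norm_map, hdiff, hnu]
  by_cases heq : x N i₀ = x N i₁
  · -- one particle serves both template points: `a ≤ 1/5`
    rw [heq] at hi₀
    have := dist_triangle_left
      (A ((((-q : ℤ) : ℝ) • triangularVec₁ a) + (((-q : ℤ) : ℝ) • triangularVec₂ a) +
        ((haggLabel s m : ℝ) • barlowOffset a) + (z m • layerNormal 1)))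
      (A ((((1 - q : ℤ) : ℝ) • triangularVec₁ a) + (((-q : ℤ) : ℝ) • triangularVec₂ a) +
        ((haggLabel s m : ℝ) • barlowOffset a) + (z m • layerNormal 1))) (x N i₁ + t)
    rw [hdist] at this
    linarith
  · -- two particles of `(fccStacking 2 (2 * Real.sqrt (2 / 3)))`: `2 ≤ 1/10 + a + 1/10`
    have h2 := two_le_dist_fccTwo (hx N i₀) (hx N i₁) heq
    have h4 := dist_triangle4 (x N i₀ + t)
      (A ((((-q : ℤ) : ℝ) • triangularVec₁ a) + (((-q : ℤ) : ℝ) • triangularVec₂ a) +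
        ((haggLabel s m : ℝ) • barlowOffset a) + (z m • layerNormal 1)))
      (A ((((1 - q : ℤ) : ℝ) • triangularVec₁ a) + (((-q : ℤ) : ℝ) • triangularVec₂ a) +
        ((haggLabel s m : ℝ) • barlowOffset a) + (z m • layerNormal 1))) (x N i₁ + t)
    rw [dist_add_right, hdist, dist_comm _ (x N i₁ + t)] at h4
    linarith


/-- **The ground-state hypothesis of `BarlowLiouville` is load-bearing (the scale is free without it).**
The crux's `Core` (= `BarlowLiouville` with the `UniformPolytypeStability` antecedent removed) with the
hypothesis `∀ N, IsGroundState lennardJones (x N)` deleted — verbatim otherwise, the crux's own `let GF /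
let HL` clauses — is FALSE: witness `x = (fun (N : ℕ) (i : Fin N) => barlowPos 2 (2 * Real.sqrt (2 / 3)) constHagg (Prod.fst (Equiv.symm (Denumerable.eqv (ℤ × ℤ × ℤ)) (i : ℕ))) (Prod.fst (Prod.snd (Equiv.symm (Denumerable.eqv (ℤ × ℤ × ℤ)) (i : ℕ)))) (Prod.snd (Prod.snd (Equiv.symm (Denumerable.eqv (ℤ × ℤ × ℤ)) (i : ℕ)))))` (the enumerated fcc packing of balls of diameter `2`),
`δ = 2`, `X = (fccStacking 2 (2 * Real.sqrt (2 / 3)))`.  Any proof of the crux must use the energetics of Lennard-Jones ground states to pin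
the nearest-neighbour distance of the hull element inside `[47/50, 1]` (up to the interlayer box).
[folklore] -/
theorem barlowLiouville_core_false_without_groundState :
    ¬ (let GF : Set (EuclideanSpace ℝ (Fin 3)) → EuclideanSpace ℝ (Fin 3) → Prop := fun S y => let d : ℝ := sInf ((fun z => dist z y) '' (S \ {y})); let T : Set (EuclideanSpace ℝ (Fin 3)) := {z : EuclideanSpace ℝ (Fin 3) | z ∈ S ∧ z ≠ y ∧ dist z y < 13 / 10 * d}; ∃ A : EuclideanSpace ℝ (Fin 3) →ₗᵢ[ℝ] EuclideanSpace ℝ (Fin 3), (∃ e : ↥T ≃ ↥Literature.Geometry.DiscreteGeometry.fccKissingPattern, ∀ t : ↥T, dist (d⁻¹ • ((t : EuclideanSpace ℝ (Fin 3)) - y)) (A ((e t : ↥Literature.Geometry.DiscreteGeometry.fccKissingPattern) : EuclideanSpace ℝ (Fin 3))) ≤ 1 / 20) ∨ (∃ e : ↥T ≃ ↥Literature.Geometry.DiscreteGeometry.hcpKissingPattern, ∀ t : ↥T, dist (d⁻¹ • ((t : EuclideanSpace ℝ (Fin 3)) - y)) (A ((e t : ↥Literature.Geometry.DiscreteGeometry.hcpKissingPattern)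 : EuclideanSpace ℝ (Fin 3))) ≤ 1 / 20); let HL : ((N : ℕ) → (Fin N → EuclideanSpace ℝ (Fin 3))) → Set (EuclideanSpace ℝ (Fin 3)) → Prop := fun x S => ∃ φ : ℕ → ℕ, StrictMono φ ∧ ∃ τ : ℕ → EuclideanSpace ℝ (Fin 3), ∀ R ε : ℝ, 0 < ε → ∀ᶠ j : ℕ in Filter.atTop, (∀ s ∈ S, ‖s‖ ≤ R → ∃ i : Fin (φ j), dist (x (φ j) i + τ j) s ≤ ε) ∧ (∀ i : Fin (φ j), ‖x (φ j) i + τ j‖ ≤ R → ∃ s ∈ S, dist (x (φ j) i + τ j) s ≤ ε); ∀ (x : (N : ℕ) → (Fin N → EuclideanSpace ℝ (Fin 3))), ∀ δ : ℝ, 0 < δ → ∀ X : Set (EuclideanSpace ℝ (Fin 3)), (∀ y ∈ X, ∀ z ∈ X, y ≠ z → δ ≤ dist y z) → HL x X → (∃ R₁ : ℝ, ∀ p : EuclideanSpace ℝ (Fin 3), ∃ y ∈ X, dist y p ≤ R₁) → (∀ y ∈ X, GF X y) → (∃ s : ℤ → ℤ, Literature.MathematicalPhysics.StatisticalMechanics.IsHaggSeq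 s ∧ ∃ Φ : EuclideanSpace ℝ (Fin 3) → EuclideanSpace ℝ (Fin 3), Set.BijOn Φ (Literature.MathematicalPhysics.StatisticalMechanics.barlowStacking 1 (Real.sqrt (2 / 3)) s) X ∧ ∀ p ∈ Literature.MathematicalPhysics.StatisticalMechanics.barlowStacking 1 (Real.sqrt (2 / 3)) s, ∃ A : EuclideanSpace ℝ (Fin 3) →ₗᵢ[ℝ] EuclideanSpace ℝ (Fin 3), ∃ l : ℝ, 0 < l ∧ ∀ q ∈ Literature.MathematicalPhysics.StatisticalMechanics.barlowStacking 1 (Real.sqrt (2 / 3)) s, dist q p ≤ 1 → dist (Φ q) (Φ p + l • A (q - p)) ≤ 1 / 20 * l) → (∃ a : ℝ, 47 / 50 ≤ a ∧ a ≤ 1 ∧ ∀ R ε : ℝ, 0 < ε → ∃ᶠ N in Filter.atTop, ∃ (A : EuclideanSpace ℝ (Fin 3) →ₗᵢ[ℝ] EuclideanSpace ℝ (Fin 3)) (t : EuclideanSpace ℝ (Fin 3)) (s : ℤ → ℤ) (z : ℤ → ℝ), Literature.MathematicalPhysics.StatisticalMechanics.IsHaggSeq s ∧ (∀ m : ℤ,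 39 / 50 * a ≤ z (m + 1) - z m ∧ z (m + 1) - z m ≤ 17 / 20 * a) ∧ let S : Set (EuclideanSpace ℝ (Fin 3)) := {p | ∃ m i j : ℤ, p = A (((i : ℝ) • Literature.MathematicalPhysics.StatisticalMechanics.triangularVec₁ a) + ((j : ℝ) • Literature.MathematicalPhysics.StatisticalMechanics.triangularVec₂ a) + ((Literature.MathematicalPhysics.StatisticalMechanics.haggLabel s m : ℝ) • Literature.MathematicalPhysics.StatisticalMechanics.barlowOffset a) + (z m • Literature.MathematicalPhysics.StatisticalMechanics.layerNormal 1))}; (∀ p ∈ S, ‖p‖ ≤ R → ∃ i : Fin N, dist (x N i + t) p ≤ ε) ∧ (∀ i : Fin N, ‖x N i + t‖ ≤ R → ∃ p ∈ S, dist (x N i + t) p ≤ ε))) := by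
  intro h
  exact not_layeredWindows_of_forall_mem (x := (fun (N : ℕ) (i : Fin N) => barlowPos 2 (2 * Real.sqrt (2 / 3)) constHagg (Prod.fst (Equiv.symm (Denumerable.eqv (ℤ × ℤ × ℤ)) (i : ℕ))) (Prod.fst (Prod.snd (Equiv.symm (Denumerable.eqv (ℤ × ℤ × ℤ)) (i : ℕ)))) (Prod.snd (Prod.snd (Equiv.symm (Denumerable.eqv (ℤ × ℤ × ℤ)) (i : ℕ)))))) (fun N i => barlowPos_mem _ _ _)
    (h (fun (N : ℕ) (i : Fin N) => barlowPos 2 (2 * Real.sqrt (2 / 3)) constHagg (Prod.fst (Equiv.symm (Denumerable.eqv (ℤ × ℤ × ℤ)) (i : ℕ))) (Prod.fst (Prod.snd (Equiv.symm (Denumerable.eqv (ℤ × ℤ × ℤ)) (i : ℕ)))) (Prod.snd (Prod.snd (Equiv.symm (Denumerable.eqv (ℤ × ℤ × ℤ)) (i : ℕ))))) 2 two_pos (fccStacking 2 (2 * Real.sqrt (2 / 3))) (fun y hy z hz hyz => two_le_dist_fccTwo hy hz hyz) hull_fccTwo relDense_fccTwo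
      (fun y hy => siteGood_fccTwo hy) templated_fccTwo)

end Summit.AtomisticToContinuum.Crystallization.Theorems.BarlowLiouville.Negative

end
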